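import Mathlib
import Summits.ResolutionOfSingularities.ResolutionOfSingularities.Theorems.RadicialJungCleanModelsCleanProp44BirthDescentIntrinsic
import HarnessLib

/-!
# Route `RadicialJung`, crux `CleanModels` (stmt-ResolutionOfSingularities-15917), line `Sketch` rev 35, stub 6 `stub_cleanProp44` (X44c):
# THE CHART IDENTIFICATION (census (S2)), LAST STEP — from «`𝒪_{E,c′}` is the localization of `κ(c)[u][T]` at `(P, T + λ)`» to EVERY
# hypothesis of ✓ `birth_descent_intrinsic`, and from «`𝒪_{E,η″}` is the localization at `(π)`» to EVERY hypothesis of ✓ `exists_successor_intrinsic`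

Seat decomp-res-hand-2 g22 (structural hand).  Hand-2 g21 left, as the one L-sized input of the `δ`-descent of a birth-chain generation
(memo 4e §2.5, census (iii)), the chart identification (S2): the local rings of the last exceptional divisor `E = E_{Z_{δ−2}}` at the births `c′_i`
and at the generic point `η″` of the near curve, READ THROUGH the `κ(c)[u][T]`-algebra structure of the cocone of ✓ `tower_face`.  Its natural
output (blueprint of the g21 memo, §0 NET (S2): ✓ `IsBlowup.exists_chartFamily` + ✓ `chartQuotEquiv` + localization of a localization along the
σ-tower) is a LOCALIZATION statement — `IsLocalization.AtPrime 𝒪_{E,c′} (C P, X + C λ)` and `IsLocalization.AtPrime 𝒪_{E,η″} (π)` over `κ(c)[u][T]`.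
THIS FILE turns exactly these two statements into the stalk-natural hypotheses consumed by g21's entry points, so that the tower transport may stop
at `IsLocalization` and never touch r.s.p. / residue / dimension bookkeeping again:

* §1 `indepModSq_of_span_pair` — in a Noetherian local ring of dimension `2`, two generators of `𝔪` are linearly independent modulo `𝔪²`
  (the `hli` currency of ✓ `descent_at_birth_intrinsic`; Krull + Nakayama, pattern of the tree's `indepModSq_of_span_eq`).
* §2 (closed point `c′`, `S` a localization of `κ[u][T]` at `𝔫₀ = (P, T + λ)`, `P` prime): `maximalIdeal_eq_map_span_pair` (`h𝔫eq`), `comap_C_span_pair` / `height_span_pair` / `ringKrullDim_of_isLocalization_span_pair` (`hdim : dim S = 2`,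
  via Mathlib's `Polynomial.height_eq_height_add_one`), `isRegularLocalRing_of_isLocalization_span_pair`, `exists_sub_algebraMap_C_of_isLocalization`
  (`hres`: every residue class is a polynomial in `u`), `indepModSq_of_isLocalization_span_pair` (`hli`).
* §3 (generic point `η″`, `D` a localization of `κ[u][T]` at `(π)`, `π` prime): `isDomain_of_isLocalization_span_prime`,
  `maximalIdeal_eq_span_of_isLocalization` (`hunif`), `comap_maximalIdeal_of_isLocalization` (`hcomap`),
  `isDiscreteValuationRing_of_isLocalization_span_prime` (Mathlib's DVR TFAE: Noetherian local domain with principal non-zero maximal ideal).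
* §4 THE COMPOSITIONS: `exists_successor_of_isLocalization` (= ✓ `exists_successor_intrinsic` with (S2) at `η″` replaced by the localization
  statement) and `birth_descent_of_isLocalization` (= ✓ `birth_descent_intrinsic` with `h𝔫eq hres hli hdim` and regularity replaced by the localization
  statements at the births).

Honest framing: OURS, elementary commutative algebra (Mathlib: `IsLocalization.AtPrime.*`, `Ideal.height`, `IsDiscreteValuationRing.TFAE`); what remains
of (S2) is to PRODUCE the two `IsLocalization.AtPrime` statements from the tree's blowings up along the σ-tower (one chart step = ✓ `chartQuotEquiv` +
`IsLocalization.isLocalization_isLocalization_atPrime_isLocalization`); nothing here proves X44c, any case of `CleanModels`, or resolution of singularities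
in characteristic `p`. [cite: Matsumura1987, Thm. 14.2, Thm. 11.1–11.2, §8] [cite: CossartPiltant2008, Lemma 4.3 (4)–(5); Prop. 4.4 (proof, p. 11)]
-/

noncomputable section

set_option linter.dupNamespace false -- mandated namespace of this single-conjunct summit

open Polynomial IsLocalRing Literature.AlgebraicGeometry.Resolution

namespace Summit.ResolutionOfSingularities.ResolutionOfSingularities.Theorems.RadicialJung.CleanModels

/-! ## §1 Two generators of the maximal ideal of a two-dimensional local ring are independent modulo `𝔪²` -/

section IndepModSq

variable {S : Type*} [CommRing S] [IsLocalRing S] [IsNoetherianRing S]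

/-- Nakayama: if `𝔪 = (a, b)` and `a ∈ (b) + 𝔪²` then `𝔪 = (b)`. [cite: Matsumura1987, §8 (Nakayama)] -/
theorem maximalIdeal_eq_span_singleton_of_mem_sup {a b : S} (h : maximalIdeal S = Ideal.span {a, b})
    (ha : a ∈ Ideal.span {b} ⊔ maximalIdeal S • maximalIdeal S) : maximalIdeal S = Ideal.span {b} := by
  have hb : b ∈ maximalIdeal S := h ▸ Ideal.subset_span (by simp)
  apply le_antisymm
  · refine Submodule.le_of_le_smul_of_le_jacobson_bot (I := maximalIdeal S) (IsNoetherian.noetherian _) ?_ ?_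
    · rw [IsLocalRing.jacobson_eq_maximalIdeal ⊥ bot_ne_top]
    · calc maximalIdeal S = Ideal.span {a, b} := h
        _ ≤ Ideal.span {b} ⊔ maximalIdeal S • maximalIdeal S := by
          refine Ideal.span_le.mpr ?_
          rintro x (rfl | rfl)
          · exact ha
          · exact Submodule.mem_sup_left (Ideal.mem_span_singleton_self _)
  · exact Ideal.span_le.mpr (by rintro x rfl; exact hb)

/-- **`hli` for two generators**: in a Noetherian local ring of dimension `2` with `𝔪 = (x, y)`, `r·x + s·y ∈ 𝔪²` forces `r, s ∈ 𝔪` (the classes of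
`x, y` form a basis of `𝔪/𝔪²`).  Pattern of the tree's `indepModSq_of_span_eq` (three generators, dimension `3`). [cite: Matsumura1987, Thm. 14.2] -/
theorem indepModSq_of_span_pair (hdim : ringKrullDim S = 2) {x y : S} (hspan : maximalIdeal S = Ideal.span {x, y}) :
    ∀ r s : S, r * x + s * y ∈ maximalIdeal S ^ 2 → r ∈ maximalIdeal S ∧ s ∈ maximalIdeal S := by
  -- Krull: `dim S ≤` the number of generators of `𝔪`, so `𝔪` is not principal
  have key : ∀ a : S, maximalIdeal S ≠ Ideal.span {a} := by
    intro a h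
    have h1 := ringKrullDim_le_spanFinrank_maximalIdeal S
    rw [hdim, h] at h1
    have h2 : (Ideal.span {a}).spanFinrank ≤ ({a} : Set S).ncard := Submodule.spanFinrank_span_le_ncard_of_finite (Set.toFinite _)
    rw [Set.ncard_singleton] at h2
    have h3 : ((Ideal.span {a}).spanFinrank : WithBot ℕ∞) ≤ (1 : ℕ) := by exact_mod_cast h2
    have := h1.trans h3
    revert this
    decide
  have hsq : maximalIdeal S ^ 2 = maximalIdeal S • maximalIdeal S := by rw [sq, smul_eq_mul]
  have hspan' : maximalIdeal S = Ideal.span {y, x} := by rw [hspan, Set.pair_comm]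
  intro r s hrs
  refine ⟨?_, ?_⟩
  · by_contra hr
    have hru : IsUnit r := by
      by_contra h; exact hr ((IsLocalRing.mem_maximalIdeal _).mpr h)
    obtain ⟨ri, hri⟩ := hru.exists_left_inv
    apply key y
    refine maximalIdeal_eq_span_singleton_of_mem_sup hspan ?_
    have hx : x = ri * (r * x + s * y) - ri * s * y := by
      calc x = (ri * r) * x := by rw [hri, one_mul]
        _ = ri * (r * x + s * y) - ri * s * y := by ring
    rw [hx]
    refine Ideal.sub_mem _ ?_ ?_
    · exact Submodule.mem_sup_right (hsq ▸ Ideal.mul_mem_left _ _ hrs)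
    · exact Submodule.mem_sup_left (Ideal.mul_mem_left _ _ (Ideal.mem_span_singleton_self _))
  · by_contra hs
    have hsu : IsUnit s := by
      by_contra h; exact hs ((IsLocalRing.mem_maximalIdeal _).mpr h)
    obtain ⟨si, hsi⟩ := hsu.exists_left_inv
    apply key x
    refine maximalIdeal_eq_span_singleton_of_mem_sup hspan' ?_
    have hy : y = si * (r * x + s * y) - si * r * x := by
      calc y = (si * s) * y := by rw [hsi, one_mul]
        _ = si * (r * x + s * y) - si * r * x := by ring
    rw [hy]
    refine Ideal.sub_mem _ ?_ ?_
    · exact Submodule.mem_sup_right (hsq ▸ Ideal.mul_mem_left _ _ hrs)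
    · exact Submodule.mem_sup_left (Ideal.mul_mem_left _ _ (Ideal.mem_span_singleton_self _))

end IndepModSq

/-! ## §2 The closed point: `S` a localization of `κ[u][T]` at `𝔫₀ = (P, T + λ)` -/

section ClosedPoint

variable {k : Type*} [Field k] (P lam : k[X])

/-- `𝔫₀ ∩ κ[u] = (P)`: the contraction of `(P, T + λ)` along `C` is `(P)`. [folklore] -/
theorem comap_C_span_pair :
    (Ideal.span ({C P, X + C lam} : Set (k[X])[X])).comap (C : k[X] →+* (k[X])[X]) = Ideal.span {P} := by
  apply le_antisymm
  · intro g hg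
    rw [Ideal.mem_comap] at hg
    have := eval_mem_span_of_mem_span_pair P lam hg
    rwa [eval_C] at this
  · rw [Ideal.span_singleton_le_iff_mem, Ideal.mem_comap]
    exact Ideal.subset_span (by simp)

/-- `ht (P) = 1` in `κ[u]` (`P` prime). [folklore] -/
theorem height_span_singleton_eq_one (hP : Prime P) : (Ideal.span ({P} : Set k[X])).height = 1 := by
  haveI : (Ideal.span {P}).IsPrime := (Ideal.span_singleton_prime hP.ne_zero).mpr hP
  haveI : (Ideal.span {P}).IsMaximal :=
    IsPrime.to_maximal_ideal (by rw [Ne, Ideal.span_singleton_eq_bot]; exact hP.ne_zero)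
  exact IsPrincipalIdealRing.height_eq_one_of_isMaximal _ (Polynomial.not_isField k)

/-- **`ht 𝔫₀ = 2`**: `(P, T + λ)` is a maximal ideal of `κ[u][T]` lying over the height-one prime `(P)` of `κ[u]` (Mathlib:
`Polynomial.height_eq_height_add_one`). [folklore] -/
theorem height_span_pair (hP : Prime P) : (Ideal.span ({C P, X + C lam} : Set (k[X])[X])).height = 2 := by
  haveI := isMaximal_span_pair P lam hP
  haveI : (Ideal.span ({C P, X + C lam} : Set (k[X])[X])).LiesOver (Ideal.span ({P} : Set k[X])) := by
    refine ⟨?_⟩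
    rw [Ideal.under_def, Polynomial.algebraMap_eq, comap_C_span_pair P lam]
  rw [Polynomial.height_eq_height_add_one (Ideal.span ({P} : Set k[X])), height_span_singleton_eq_one P hP]
  rfl

variable (S : Type*) [CommRing S] [Algebra (k[X])[X] S] [IsLocalRing S]
  [h𝔔 : (Ideal.span ({C P, X + C lam} : Set (k[X])[X])).IsPrime]
  [hS : IsLocalization.AtPrime S (Ideal.span ({C P, X + C lam} : Set (k[X])[X]))]

include h𝔔 hS

/-- **`h𝔫eq`**: `𝔫_S = 𝔫₀ S`. [folklore] -/
theorem maximalIdeal_eq_map_span_pair :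
    maximalIdeal S = (Ideal.span ({C P, X + C lam} : Set (k[X])[X])).map (algebraMap (k[X])[X] S) :=
  (IsLocalization.AtPrime.map_eq_maximalIdeal (Ideal.span ({C P, X + C lam} : Set (k[X])[X])) S).symm

/-- `𝔫_S = (P, T + λ)S` as a span of the two images. [folklore] -/
theorem maximalIdeal_eq_span_pair_algebraMap :
    maximalIdeal S = Ideal.span {algebraMap (k[X])[X] S (C P), algebraMap (k[X])[X] S (X + C lam)} := by
  rw [maximalIdeal_eq_map_span_pair P lam S, Ideal.map_span, Set.image_pair]

omit [IsLocalRing S] in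
/-- **`hdim`**: `dim S = 2`. [folklore] -/
theorem ringKrullDim_of_isLocalization_span_pair (hP : Prime P) : ringKrullDim S = 2 := by
  rw [IsLocalization.AtPrime.ringKrullDim_eq_height (Ideal.span ({C P, X + C lam} : Set (k[X])[X])) S, height_span_pair P lam hP]
  rfl

/-- **`S` is a regular local ring** (dimension `2`, maximal ideal on two generators). [cite: Matsumura1987, Thm. 14.2] -/
theorem isRegularLocalRing_of_isLocalization_span_pair (hP : Prime P) : IsRegularLocalRing S := by
  haveI : IsNoetherianRing S := IsLocalization.isNoetherianRing (Ideal.span ({C P, X + C lam} : Set (k[X])[X])).primeCompl S inferInstance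
  refine IsRegularLocalRing.of_spanFinrank_maximalIdeal_le S ?_
  rw [ringKrullDim_of_isLocalization_span_pair P lam S hP, maximalIdeal_eq_span_pair_algebraMap P lam S]
  have h2 : (Ideal.span {algebraMap (k[X])[X] S (C P), algebraMap (k[X])[X] S (X + C lam)}).spanFinrank ≤
      ({algebraMap (k[X])[X] S (C P), algebraMap (k[X])[X] S (X + C lam)} : Set S).ncard :=
    Submodule.spanFinrank_span_le_ncard_of_finite (Set.toFinite _)
  have h3 : ({algebraMap (k[X])[X] S (C P), algebraMap (k[X])[X] S (X + C lam)} : Set S).ncard ≤ 2 :=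
    (Set.ncard_insert_le _ _).trans (by simp)
  exact_mod_cast h2.trans h3

/-- **`hres`**: every element of `S` is congruent modulo `𝔫_S` to (the image of) a polynomial `g(u)` — the residue field of `c′` is `κ[u]/(P)`.
[folklore] -/
theorem exists_sub_algebraMap_C_of_isLocalization (hP : Prime P) (z : S) :
    ∃ g : k[X], z - algebraMap (k[X])[X] S (C g) ∈ maximalIdeal S := by
  refine exists_sub_algebraMap_C_mem_maximalIdeal P lam hP (maximalIdeal_eq_map_span_pair P lam S).symm.le (fun z => ?_) z
  obtain ⟨⟨f, s⟩, h⟩ := IsLocalization.surj (Ideal.span ({C P, X + C lam} : Set (k[X])[X])).primeCompl z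
  exact ⟨f, s.1, s.2, h⟩

/-- **`hli`**: `α·P + β·(T + λ) ∈ 𝔫_S²` forces `α, β ∈ 𝔫_S`. [cite: Matsumura1987, Thm. 14.2] -/
theorem indepModSq_of_isLocalization_span_pair (hP : Prime P) :
    ∀ α β : S, α * algebraMap (k[X])[X] S (C P) + β * algebraMap (k[X])[X] S (X + C lam) ∈ maximalIdeal S ^ 2 →
      α ∈ maximalIdeal S ∧ β ∈ maximalIdeal S := by
  haveI : IsNoetherianRing S := IsLocalization.isNoetherianRing (Ideal.span ({C P, X + C lam} : Set (k[X])[X])).primeCompl S inferInstance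
  exact indepModSq_of_span_pair (ringKrullDim_of_isLocalization_span_pair P lam S hP) (maximalIdeal_eq_span_pair_algebraMap P lam S)

end ClosedPoint

/-! ## §3 The generic point of the near curve: `D` a localization of `κ[u][T]` at a height-one prime `(π)` -/

section GenericPoint

variable {k : Type*} [Field k] (π : (k[X])[X])
variable (D : Type*) [CommRing D] [Algebra (k[X])[X] D] [IsLocalRing D]
  [h𝔭 : (Ideal.span ({π} : Set (k[X])[X])).IsPrime] [hD : IsLocalization.AtPrime D (Ideal.span ({π} : Set (k[X])[X]))]

include h𝔭 hD

omit [IsLocalRing D] in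
/-- `D` is a domain. [folklore] -/
theorem isDomain_of_isLocalization_span_prime : IsDomain D :=
  IsLocalization.isDomain_of_le_nonZeroDivisors D (Ideal.primeCompl_le_nonZeroDivisors (Ideal.span ({π} : Set (k[X])[X])))

/-- **`hunif`**: `𝔫_D = (π)D`. [folklore] -/
theorem maximalIdeal_eq_span_of_isLocalization : maximalIdeal D = Ideal.span {algebraMap (k[X])[X] D π} := by
  rw [← IsLocalization.AtPrime.map_eq_maximalIdeal (Ideal.span ({π} : Set (k[X])[X])) D, Ideal.map_span, Set.image_singleton]

/-- **`hcomap`**: `𝔫_D ∩ κ[u][T] = (π)`. [folklore] -/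
theorem comap_maximalIdeal_of_isLocalization :
    (maximalIdeal D).comap (algebraMap (k[X])[X] D) = Ideal.span {π} :=
  IsLocalization.AtPrime.under_maximalIdeal D (Ideal.span ({π} : Set (k[X])[X]))

/-- **`D` is a discrete valuation ring** (Noetherian local domain whose maximal ideal is principal and non-zero; Mathlib's DVR TFAE).
[cite: Matsumura1987, Thm. 11.1–11.2] -/
theorem isDiscreteValuationRing_of_isLocalization_span_prime [IsDomain D] (hπ : Prime π) : IsDiscreteValuationRing D := by
  haveI : IsNoetherianRing D := IsLocalization.isNoetherianRing (Ideal.span ({π} : Set (k[X])[X])).primeCompl D inferInstance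
  have hunif := maximalIdeal_eq_span_of_isLocalization π D
  have hne : maximalIdeal D ≠ ⊥ := by
    rw [hunif, Ne, Ideal.span_singleton_eq_bot]
    intro h0
    have hinj := IsLocalization.injective D (Ideal.primeCompl_le_nonZeroDivisors (Ideal.span ({π} : Set (k[X])[X])))
    exact hπ.ne_zero (hinj (by rw [h0, map_zero]))
  have hnf : ¬ IsField D := fun hF => hne ((IsLocalRing.isField_iff_maximalIdeal_eq).mp hF)
  have htfae := (IsDiscreteValuationRing.TFAE D hnf).out 0 4
  rw [htfae, hunif]
  infer_instance

end GenericPoint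

/-! ## §4 The compositions with g21's entry points -/

section Composition

variable {k : Type*} [Field k]

/-- **STEP 1 from the localization statement at `η″`**: ✓ `exists_successor_intrinsic` with the DVR / `hunif` / `hcomap` hypotheses discharged by
«`D = 𝒪_{E,η″}` is the localization of `κ(c)[u][T]` at `(π)`». [cite: CossartPiltant2008, Lemma 4.3 (5); Prop. 4.4 (proof, p. 11)] -/
theorem exists_successor_of_isLocalization {Φ π : (k[X])[X]} {μ δ : ℕ} (hμ : 1 ≤ μ) (hdeg : Φ.natDegree ≤ μ) {c : k} (hc : c ≠ 0)
    (htop : Φ.coeff μ = C c) (hC0 : (Φ.coeff 0).natDegree ≤ μ * δ) (hδ : (δ : k) = 0) (hπ : Prime π)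
    (D : Type*) [CommRing D] [Algebra (k[X])[X] D] [IsLocalRing D] [(Ideal.span ({π} : Set (k[X])[X])).IsPrime]
    [IsLocalization.AtPrime D (Ideal.span ({π} : Set (k[X])[X]))]
    (hΦ : algebraMap (k[X])[X] D Φ ∈ maximalIdeal D ^ μ) :
    ∃ (a : k) (lam : k[X]), a ≠ 0 ∧ π = C (C a) * (X + C lam) ∧ Φ = C (C c) * (X + C lam) ^ μ ∧ lam.natDegree ≤ δ ∧
      (derivative lam).natDegree ≤ δ - 2 := by
  haveI := isDomain_of_isLocalization_span_prime π D
  haveI := isDiscreteValuationRing_of_isLocalization_span_prime π D hπ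
  exact exists_successor_intrinsic hμ hdeg hc htop hC0 hδ hπ (algebraMap (k[X])[X] D) (maximalIdeal_eq_span_of_isLocalization π D)
    (comap_maximalIdeal_of_isLocalization π D) hΦ

variable (p : ℕ) [Fact p.Prime] [CharP k p]
variable {ι : Type*} (s : Finset ι) (Si : ι → Type*) [∀ i, CommRing (Si i)] [∀ i, Algebra (k[X])[X] (Si i)] [∀ i, IsLocalRing (Si i)]

/-- **STEP 2 from the localization statements at the births**: ✓ `birth_descent_intrinsic` with `h𝔫eq`, `hres`, `hli`, `hdim` and the regularity of
`S_i = 𝒪_{E,c′_i}` discharged by «`S_i` is the localization of `κ(c)[u][T]` at `(P_i, T + λ)`».  Remaining inputs: the face data, the primes `P_i`,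
`w_i ∈ 𝔫_{S_i}` (S4) and the surrogate along `K_i` (S4). [cite: CossartPiltant2008, Prop. 4.4 (proof, p. 11)] [cite: CossartPiltant2009, ch.1 II.5.3.2 (i)] -/
theorem birth_descent_of_isLocalization {c : k} (hc : c ≠ 0) {a₀ : k} (ha₀ : a₀ ≠ 0) (lam : k[X]) {μ δ : ℕ} (hμ : 0 < μ)
    (hlam : lam.natDegree ≤ δ) (hδ : (δ : k) = 0) (hlam' : derivative lam ≠ 0)
    (P : ι → k[X]) (hP : ∀ i, Prime (P i)) (hne : ∀ i ∈ s, ∀ j ∈ s, i ≠ j → ¬ P i ∣ P j)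
    [∀ i, (Ideal.span ({C (P i), X + C lam} : Set (k[X])[X])).IsPrime]
    [∀ i, IsLocalization.AtPrime (Si i) (Ideal.span ({C (P i), X + C lam} : Set (k[X])[X]))]
    (G : ∀ i, Si i) (d' : ι → ℕ) (hd'1 : ∀ i ∈ s, 1 ≤ d' i)
    (hw𝔫 : ∀ i ∈ s, algebraMap (k[X])[X] (Si i) (C (C a₀) * X) - G i ^ p ∈ maximalIdeal (Si i))
    (hf : ∀ i ∈ s, algebraMap (k[X])[X] (Si i) (C (C c) * (X + C lam) ^ μ) ∈
      Ideal.span {algebraMap (k[X])[X] (Si i) (C (C a₀) * X) - G i ^ p} ⊔ maximalIdeal (Si i) ^ (μ * d' i)) :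
    (∑ i ∈ s, (d' i - 1) * (P i).natDegree ≤ δ - 2) ∧ ∀ i ∈ s, d' i ≤ δ - 1 := by
  haveI : ∀ i, IsRegularLocalRing (Si i) := fun i => isRegularLocalRing_of_isLocalization_span_pair (P i) lam (Si i) (hP i)
  exact birth_descent_intrinsic p s Si hc ha₀ lam hμ hlam hδ hlam' P (fun i _ => hP i) hne G d' hd'1
    (fun i _ => maximalIdeal_eq_map_span_pair (P i) lam (Si i))
    (fun i _ => exists_sub_algebraMap_C_of_isLocalization (P i) lam (Si i) (hP i))
    (fun i _ => indepModSq_of_isLocalization_span_pair (P i) lam (Si i) (hP i))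
    (fun i _ => ringKrullDim_of_isLocalization_span_pair (P i) lam (Si i) (hP i)) hw𝔫 hf

end Composition

end Summit.ResolutionOfSingularities.ResolutionOfSingularities.Theorems.RadicialJung.CleanModels

end
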